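import Mathlib
import Literature.AlgebraicGeometry.Resolution.PointBlowupFlagMaximalShift
import Summits.ResolutionOfSingularities.ResolutionOfSingularities.Theorems.WeightedInvariantLocalWeightedDropWildPurePowerFlagTangent
import Summits.ResolutionOfSingularities.ResolutionOfSingularities.Theorems.WeightedInvariantLocalWeightedDropWildPurePowerFlagStatements

/-!
# `WeightedInvariant.LocalWeightedDrop`, line `hasse-ridge-face-selection`, piece S3πM: [Hauser–Perlega, Prop. 3] for the game-side
# flag invariant — `AttainStatement` holds

Crux item stmt-ResolutionOfSingularities-8899 `LocalWeightedDrop` (route `ResolutionOfSingularities/WeightedInvariant`), serving the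
door `WeightedConstruction` stmt-ResolutionOfSingularities-0571.  [OURS · L1 W4.3, chain w43, stub worker 1 (gen 3); not a statement of any
manuscript.  The printed source is H. Hauser, S. Perlega, PRIMS **60** (2024), Prop. 3 p. 791–792: "There exists a maximizing flag 𝓕 ∈ F
with inv^𝓕_a(X) ∈ ℕ³ and d_𝓕 > 0."]

`attainStatement_holds : AttainStatement p e k` (every `p`, `e`, every field `k` of characteristic `p`): at a clean, non-zero,
non-terminal position `(B, E)` the set of flag triples `{v | IsFlagTriple q B E v}` has a greatest element, of finite `s`.  Assembly of:
the `s`-side per orientation (stub worker 6's series-level Prop 3-s `exists_isGreatest_inf_rows_or_monomial` for `d_res ≥ q`, the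
companion bound for `0 < d_res < q`, the lowest row of the residual factor for the flag `h = 0` when `y` is exceptional), `d_res ≥ 1`
(`dRes_pos_of_not_termSub`), and the `(d, n)`-side (`dFlag_le_order`, `exists_bound_dFlag_eq_zero`): the tangent triples with
`d_𝓕 ≥ 1` form a FINITE set, those with `d_𝓕 = 0` are dominated by the trivial flag, so the greatest triple is the maximum of
finitely many candidates.
-/

set_option linter.dupNamespace false -- mandated namespace of this single-conjunct summit

namespace Summit.ResolutionOfSingularities.ResolutionOfSingularities.Theorems

open Literature.AlgebraicGeometry.Resolution
open Literature.AlgebraicGeometry.Resolution.HauserPerlega2024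

namespace PurePowerFlag

open MvPowerSeries

variable {k : Type} [Field k]

/-! ### The rows of the residual factor -/

/-- With `y` not exceptional the exceptional monomial is `x^r`, `r = excExp B E 0`. -/
theorem excExp_eq_single_of_not_mem {B : MvPowerSeries (Fin 2) k} {E : Finset (Fin 2)} (h1 : (1 : Fin 2) ∉ E) :
    excExp B E = Finsupp.single 0 (excExp B E 0) := by
  ext i
  rcases letter_cases i with rfl | rfl
  · rw [Finsupp.single_eq_same]
  · rw [excExp_apply_of_not_mem h1, Finsupp.single_apply, if_neg (by decide)]

/-- The rows of the residual factor are the rows of the expansion relative to the exceptional monomial. -/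
theorem coeff_residual (q : ℕ) (B : MvPowerSeries (Fin 2) k) (E : Finset (Fin 2)) (h : PowerSeries k) (a i : ℕ) :
    coeff (Finsupp.single 0 a + Finsupp.single 1 i) (residual q B E h) =
      coeff (Finsupp.single 0 (excExp B E 0 + a) + Finsupp.single 1 (excExp B E 1 + i)) (expansion q B h) := by
  have hd : Finsupp.single (0 : Fin 2) a + Finsupp.single 1 i + excExp B E =
      Finsupp.single 0 (excExp B E 0 + a) + Finsupp.single 1 (excExp B E 1 + i) := by
    ext j
    rcases letter_cases j with rfl | rfl
    · simp; ring
    · simp; ring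
  unfold residual
  show coeff (Finsupp.single 0 a + Finsupp.single 1 i + excExp B E) (expansion q B h) = _
  rw [hd]

/-- `s_𝓕` UNFOLDED (branch `d_res ≥ q` or `d_res = 0`), as the `Finset.inf` of the series-level files: the rows are those of the cleaned
expansion relative to `x^{r₀} y^{r₁}`, `r = excExp B E`. -/
theorem sFlag_eq_inf (q : ℕ) (B : MvPowerSeries (Fin 2) k) (E : Finset (Fin 2)) (h : PowerSeries k)
    (hd : q ≤ dRes B E ∨ dRes B E = 0) :
    sFlag q B E h = (Finset.range (dRes B E)).inf fun i => (((dRes B E).factorial / (dRes B E - i) : ℕ) : ℕ∞) *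
      (PowerSeries.mk fun v => coeff (Finsupp.single 0 (excExp B E 0 + v) + Finsupp.single 1 (excExp B E 1 + i))
        (expansion q B h)).order := by
  unfold sFlag
  rw [if_pos hd]
  unfold coeffIdealOrder
  rw [← Finset.inf_eq_iInf]
  refine Finset.inf_congr rfl fun i _ => ?_
  rw [rowOrder_eq_order_mk]
  congr 2
  ext v
  rw [PowerSeries.coeff_mk, PowerSeries.coeff_mk, coeff_residual]

/-- `s_𝓕` UNFOLDED in the companion branch `0 < d_res < q`. -/
theorem sFlag_eq_min (q : ℕ) (B : MvPowerSeries (Fin 2) k) (E : Finset (Fin 2)) (h : PowerSeries k)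
    (hd : ¬ (q ≤ dRes B E ∨ dRes B E = 0)) :
    sFlag q B E h = min (coeffIdealOrder ((q - dRes B E) * dRes B E) (0 : Fin 2) 1
        ((monomial (excExp B E) (1 : k)) ^ dRes B E))
      (coeffIdealOrder ((q - dRes B E) * dRes B E) (0 : Fin 2) 1 ((residual q B E h) ^ (q - dRes B E))) := by
  unfold sFlag
  rw [if_neg hd]

/-- The coefficient-ideal order is at most the contribution of row `0`. -/
theorem coeffIdealOrder_le_row_zero {c : ℕ} (hc : 0 < c) (H : MvPowerSeries (Fin 2) k) :
    coeffIdealOrder c (0 : Fin 2) 1 H ≤ ((c.factorial / c : ℕ) : ℕ∞) * rowOrder (0 : Fin 2) 1 H 0 := by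
  unfold coeffIdealOrder
  have := iInf₂_le (f := fun i (_ : i ∈ Finset.range c) => ((c.factorial / (c - i) : ℕ) : ℕ∞) * rowOrder (0 : Fin 2) 1 H i)
    0 (Finset.mem_range.mpr hc)
  rwa [Nat.sub_zero] at this

/-- A non-zero coefficient on a row bounds its row order. -/
theorem rowOrder_le_of_coeff_ne_zero {H : MvPowerSeries (Fin 2) k} {a i : ℕ}
    (h : coeff (Finsupp.single (0 : Fin 2) a + Finsupp.single 1 i) H ≠ 0) : rowOrder (0 : Fin 2) 1 H i ≤ (a : ℕ∞) :=
  iInf₂_le a h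

/-! ### Restriction to the row `y = 0` -/

/-- The restriction `H(x, 0)` of a plane series to the line `y = 0`, as a substitution (hence a ring homomorphism). -/
theorem hasSubst_rowZero : HasSubst (fun i : Fin 2 => if i = (0 : Fin 2) then (PowerSeries.X : PowerSeries k) else 0) :=
  hasSubst_of_constantCoeff_zero fun i => by
    split_ifs
    · exact PowerSeries.constantCoeff_X
    · exact map_zero _

/-- The coefficients of `H(x, 0)` are the coefficients of `H` on the row `y = 0`. -/
theorem coeff_subst_rowZero (H : MvPowerSeries (Fin 2) k) (a : ℕ) :
    PowerSeries.coeff a (subst (fun i : Fin 2 => if i = (0 : Fin 2) then (PowerSeries.X : PowerSeries k) else 0) H) =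
      coeff (Finsupp.single (0 : Fin 2) a) H := by
  classical
  have hprod : ∀ d : Fin 2 →₀ ℕ, (d.prod fun s n => (if s = (0 : Fin 2) then (PowerSeries.X : PowerSeries k) else 0) ^ n) =
      PowerSeries.X ^ d 0 * (0 : PowerSeries k) ^ d 1 := fun d => by
    rw [Finsupp.prod_fintype _ _ (fun i => pow_zero _), Fin.prod_univ_two]
    simp
  show MvPowerSeries.coeff (Finsupp.single () a) _ = _
  rw [coeff_subst hasSubst_rowZero H, finsum_eq_single _ (Finsupp.single (0 : Fin 2) a)]
  · rw [hprod]
    simp only [Finsupp.single_eq_same, Finsupp.single_eq_of_ne (show (1 : Fin 2) ≠ 0 by decide), pow_zero, mul_one]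
    rw [show MvPowerSeries.coeff (Finsupp.single () a) ((PowerSeries.X : PowerSeries k) ^ a) =
      PowerSeries.coeff a ((PowerSeries.X : PowerSeries k) ^ a) from rfl, PowerSeries.coeff_X_pow_self, smul_eq_mul, mul_one]
  · intro d hd
    rw [hprod]
    by_cases hd1 : d 1 = 0
    · have hd0 : d 0 ≠ a := by
        intro h0; apply hd
        rw [Literature.NumberTheory.EllipticCurves.finsupp_fin_two_eq d, h0, hd1, Finsupp.single_zero, add_zero]
      rw [hd1, pow_zero, mul_one, show MvPowerSeries.coeff (Finsupp.single () a) ((PowerSeries.X : PowerSeries k) ^ d 0) =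
        PowerSeries.coeff a ((PowerSeries.X : PowerSeries k) ^ d 0) from rfl, PowerSeries.coeff_X_pow, if_neg (Ne.symm hd0),
        smul_zero]
    · rw [zero_pow hd1, mul_zero, map_zero, smul_zero]

/-- Row `0` of a power: if row `0` of `G` is non-zero, so is row `0` of `G^m` (restriction to `y = 0` is a ring homomorphism into the
domain `k[[x]]`). -/
theorem rowOrder_zero_pow_ne_top {G : MvPowerSeries (Fin 2) k} (hG : rowOrder (0 : Fin 2) 1 G 0 ≠ ⊤) (m : ℕ) :
    rowOrder (0 : Fin 2) 1 (G ^ m) 0 ≠ ⊤ := by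
  set ρ : MvPowerSeries (Fin 2) k → PowerSeries k :=
    fun H => subst (fun i : Fin 2 => if i = (0 : Fin 2) then (PowerSeries.X : PowerSeries k) else 0) H with hρ
  have hrow : ∀ H : MvPowerSeries (Fin 2) k, rowOrder (0 : Fin 2) 1 H 0 = (ρ H).order := by
    intro H
    rw [rowOrder_eq_order_mk]
    congr 1
    ext v
    rw [PowerSeries.coeff_mk, hρ, coeff_subst_rowZero, Finsupp.single_zero, add_zero]
  rw [hrow] at hG ⊢
  have hGne : ρ G ≠ 0 := fun h0 => hG (by rw [h0, PowerSeries.order_zero])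
  have hpow : ρ (G ^ m) = ρ G ^ m := by rw [hρ]; exact subst_pow hasSubst_rowZero G m
  rw [hpow]
  exact fun h0 => pow_ne_zero m hGne (PowerSeries.order_eq_top.mp h0)

/-! ### Prop. 3, `s`-side, one orientation -/

/-- The tangency of a genuine shift is positive. -/
theorem one_le_tangency {h : PowerSeries k} (h0 : PowerSeries.constantCoeff h = 0) (hne : h ≠ 0) : 1 ≤ tangency h := by
  unfold tangency
  have hfin : h.order ≠ ⊤ := fun h' => hne (PowerSeries.order_eq_top.mp h')
  obtain ⟨n, hn⟩ := ENat.ne_top_iff_exists.mp hfin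
  rw [← hn, ENat.toNat_coe]
  by_contra hlt
  have hn0 : n = 0 := by omega
  have hc := PowerSeries.coeff_order hne
  rw [← hn, ENat.toNat_coe, hn0, PowerSeries.coeff_zero_eq_constantCoeff, h0] at hc
  exact hc rfl

/-- A HIDDEN MONOMIAL along a shift makes the position terminal up to that triangular change. [HP24 Prop. 3 proof p. 792 l. 36–40] -/
theorem termSub_of_expansion_eq_monomial_mul {q : ℕ} {B : MvPowerSeries (Fin 2) k} {h : PowerSeries k}
    (h0 : PowerSeries.constantCoeff h = 0) {r d : ℕ} {u : MvPowerSeries (Fin 2) k}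
    (hexp : expansion q B h = monomial (Finsupp.single 0 r + Finsupp.single 1 d) (1 : k) * u)
    (hu : constantCoeff u ≠ 0) (hnd : ¬ (q ∣ r ∧ q ∣ d)) : TermSub q B := by
  refine ⟨false, h, h0, Or.inl ⟨r, d, u, hu, hnd, ?_⟩⟩
  rw [orient_false, hexp, X_pow_eq, X_pow_eq, monomial_mul_monomial, one_mul]

/-- [HP24, Prop. 3], `s`-SIDE, FIRST ORIENTATION: at a clean, non-zero, non-terminal position the `n = 0` flags `V(y + h(x))` have one of
GREATEST `s_𝓕`, and that `s_𝓕` is finite.  (Branch `d_res ≥ q`: stub worker 6's series-level `exists_isGreatest_inf_rows_or_monomial`,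
the hidden-monomial alternative being excluded by non-terminality; branch `0 < d_res < q`: the companion ideal bounds `s` uniformly;
`y` exceptional: the only flag is `h = 0`, and row `0` of the residual factor is non-zero.) [HP24 Prop. 3 p. 791–792] -/
theorem exists_isN0_max (p : ℕ) [Fact p.Prime] [CharP k p] (e : ℕ) {B : MvPowerSeries (Fin 2) k} (E : Finset (Fin 2))
    (hB : B ≠ 0) (hclean : cleanSeries (p ^ e) B = B) (hT : ¬ TermSub (p ^ e) B) :
    ∃ h₀ : PowerSeries k, PowerSeries.constantCoeff h₀ = 0 ∧ IsN0 E h₀ ∧ sFlag (p ^ e) B E h₀ ≠ ⊤ ∧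
      ∀ h, PowerSeries.constantCoeff h = 0 → IsN0 E h → sFlag (p ^ e) B E h ≤ sFlag (p ^ e) B E h₀ := by
  classical
  set q := p ^ e with hq
  set d := dRes B E with hddef
  have hd : 0 < d := dRes_pos_of_not_termSub E hB hclean hT
  have hq1 : 1 ≤ q := Nat.one_le_pow _ _ (Fact.out : p.Prime).pos
  by_cases h1 : (1 : Fin 2) ∈ E
  · -- `y` exceptional: the only `n = 0` flag is `h = 0`
    refine ⟨0, map_zero _, Or.inr rfl, ?_, fun h _ hN => ?_⟩
    swap
    · have : h = 0 := hN.resolve_left (fun hh => hh h1)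
      rw [this]
    -- row `0` of the residual factor is non-zero
    have hrow : rowOrder (0 : Fin 2) 1 (residual q B E 0) 0 ≠ ⊤ := by
      obtain ⟨d₁, hd₁, hd₁y⟩ := exists_coeff_ne_zero_ordAlong (1 : Fin 2) hB
      have hM := excExp_le E hd₁
      have hM1 : excExp B E 1 = d₁ 1 := by
        rw [excExp_apply_of_mem h1, hd₁y, ENat.toNat_coe]
      refine ne_top_of_le_ne_top (ENat.coe_ne_top (d₁ 0 - excExp B E 0)) (rowOrder_le_of_coeff_ne_zero ?_)
      rw [coeff_residual, expansion_zero, hclean, add_zero, Nat.add_sub_cancel' (hM 0), hM1, ← Literature.NumberTheory.EllipticCurves.finsupp_fin_two_eq d₁]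
      exact hd₁
    by_cases hbr : q ≤ d ∨ d = 0
    · unfold sFlag
      rw [← hddef, if_pos hbr]
      exact ne_top_of_le_ne_top (WithTop.mul_ne_top (ENat.coe_ne_top _) hrow) (coeffIdealOrder_le_row_zero hd _)
    · rw [sFlag_eq_min q B E 0 (by rw [← hddef]; exact hbr), ← hddef]
      have hc : 0 < (q - d) * d := Nat.mul_pos (by omega) hd
      refine ne_top_of_le_ne_top ?_ (min_le_right _ _)
      exact ne_top_of_le_ne_top (WithTop.mul_ne_top (ENat.coe_ne_top _) (rowOrder_zero_pow_ne_top hrow _))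
        (coeffIdealOrder_le_row_zero hc _)
  · -- `y` not exceptional: every shift is an `n = 0` flag; the exceptional monomial is `x^r`
    set r := excExp B E 0 with hrdef
    have hM1 : excExp B E 1 = 0 := excExp_apply_of_not_mem h1
    have hxr : ∀ m, coeff m B ≠ 0 → r ≤ m 0 := fun m hm => excExp_le E hm 0
    have hsum : d + r = B.order.toNat := by
      have := dRes_add_degree_excExp hB E; rw [hM1, add_zero] at this; exact this
    have hminH : ∀ m, coeff m B ≠ 0 → r + d ≤ m 0 + m 1 := fun m hm => by
      rw [add_comm, hsum]; exact order_toNat_le_degree hm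
    have hexH : ∃ m, coeff m (cleanSeries q B) ≠ 0 ∧ m 0 + m 1 = r + d := by
      obtain ⟨m, hm, hdeg⟩ := exists_coeff_ne_zero_degree_eq_order hB
      exact ⟨m, by rw [hclean]; exact hm, by rw [hdeg, ← hsum, add_comm]⟩
    by_cases hqd : q ≤ d
    · -- branch `d_res ≥ q`: the series-level Prop. 3-s
      set R : PowerSeries k → ℕ → PowerSeries k := fun φ j => PowerSeries.mk fun v =>
        coeff (Finsupp.single 0 (r + v) + Finsupp.single 1 j) (expansion q B φ) with hRdef
      have hR : ∀ φ j v, PowerSeries.coeff v (R φ j) = coeff (Finsupp.single 0 (r + v) + Finsupp.single 1 j)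
          (cleanSeries q (subst (fun l => if l = (1 : Fin 2) then
            (X (1 : Fin 2) : MvPowerSeries (Fin 2) k) + PowerSeries.subst (X (0 : Fin 2) : MvPowerSeries (Fin 2) k) φ
            else X l) B)) := fun φ j v => by rw [hRdef, PowerSeries.coeff_mk]; rfl
      have hs : ∀ φ, sFlag q B E φ = (Finset.range d).inf (fun i => ((d.factorial / (d - i) : ℕ) : ℕ∞) * (R φ i).order) := by
        intro φ
        rw [sFlag_eq_inf q B E φ (Or.inl (by rw [← hddef]; exact hqd)), ← hddef]
        refine Finset.inf_congr rfl fun i _ => ?_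
        congr 2
        ext v
        rw [PowerSeries.coeff_mk, hRdef, PowerSeries.coeff_mk, hM1, zero_add]
      rcases exists_isGreatest_inf_rows_or_monomial p (0 : Fin 2) 1 (by decide) letter_cases B r d hqd hxr hminH hexH R hR
        with ⟨φ, hφ0, u, hexp, hu, hnd⟩ | ⟨φ, hφ0, hfin, hmax⟩
      · exact absurd (termSub_of_expansion_eq_monomial_mul hφ0 hexp hu hnd) hT
      · refine ⟨φ, hφ0, Or.inl h1, ?_, fun h h0 _ => ?_⟩
        · rw [hs]; exact hfin.ne
        · rw [hs, hs]; exact hmax h h0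
    · -- branch `0 < d_res < q`: the companion ideal bounds `s` uniformly
      have hbr : ¬ (q ≤ d ∨ d = 0) := by push Not; exact ⟨by omega, hd.ne'⟩
      have hc : 0 < (q - d) * d := Nat.mul_pos (by omega) hd
      set β : ℕ∞ := coeffIdealOrder ((q - d) * d) (0 : Fin 2) 1 ((monomial (excExp B E) (1 : k)) ^ d) with hβdef
      have hβ : β ≠ ⊤ := by
        have hpow : (monomial (excExp B E) (1 : k)) ^ d = monomial (Finsupp.single (0 : Fin 2) (r * d) + Finsupp.single 1 0) 1 := by
          rw [excExp_eq_single_of_not_mem h1, ← hrdef, ← X_pow_eq, ← pow_mul, X_pow_eq, Finsupp.single_zero, add_zero]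
        refine ne_top_of_le_ne_top (WithTop.mul_ne_top (ENat.coe_ne_top _) ?_) (coeffIdealOrder_le_row_zero hc _)
        refine ne_top_of_le_ne_top (ENat.coe_ne_top (r * d)) (rowOrder_le_of_coeff_ne_zero ?_)
        rw [hpow, coeff_monomial_same]
        exact one_ne_zero
      have hle : ∀ h, sFlag q B E h ≤ β := fun h => by
        rw [sFlag_eq_min q B E h (by rw [← hddef]; exact hbr), ← hddef]
        exact min_le_left _ _
      have hfinall : ∀ h, sFlag q B E h ≠ ⊤ := fun h => ne_top_of_le_ne_top hβ (hle h)
      -- the supremum of the (bounded) natural values is attained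
      set T : Set ℕ := {n | ∃ h : PowerSeries k, PowerSeries.constantCoeff h = 0 ∧ sFlag q B E h = n} with hT'
      have h00 : PowerSeries.constantCoeff (0 : PowerSeries k) = 0 := map_zero _
      have hT0 : (sFlag q B E 0).toNat ∈ T := ⟨0, h00, (ENat.coe_toNat (hfinall 0)).symm⟩
      have hbdd : BddAbove T := by
        refine ⟨β.toNat, fun n hn => ?_⟩
        obtain ⟨h, -, hn⟩ := hn
        have h1' := hle h
        rw [hn, ← ENat.coe_toNat hβ] at h1'
        exact_mod_cast h1'
      obtain ⟨h₀, hh₀, hsh₀⟩ := Nat.sSup_mem ⟨_, hT0⟩ hbdd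
      refine ⟨h₀, hh₀, Or.inl h1, hfinall h₀, fun h h0 _ => ?_⟩
      have hh : sFlag q B E h = ((sFlag q B E h).toNat : ℕ∞) := (ENat.coe_toNat (hfinall h)).symm
      rw [hh, hsh₀]
      exact_mod_cast le_csSup hbdd ⟨h, h0, hh⟩

/-- The same for either orientation `o`. -/
theorem exists_isN0_max_orient (p : ℕ) [Fact p.Prime] [CharP k p] (e : ℕ) {B : MvPowerSeries (Fin 2) k} (E : Finset (Fin 2))
    (hB : B ≠ 0) (hclean : cleanSeries (p ^ e) B = B) (hT : ¬ TermSub (p ^ e) B) (o : Bool) :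
    ∃ h₀ : PowerSeries k, PowerSeries.constantCoeff h₀ = 0 ∧ IsN0 (orientE o E) h₀ ∧
      sFlag (p ^ e) (orient o B) (orientE o E) h₀ ≠ ⊤ ∧
      ∀ h, PowerSeries.constantCoeff h = 0 → IsN0 (orientE o E) h →
        sFlag (p ^ e) (orient o B) (orientE o E) h ≤ sFlag (p ^ e) (orient o B) (orientE o E) h₀ := by
  cases o
  · exact exists_isN0_max p e E hB hclean hT
  · rw [orient_true, orientE_true]
    exact exists_isN0_max p e (swapE E) (swap_ne_zero hB) (by rw [cleanSeries_swap, hclean]) (by rw [termSub_swap]; exact hT)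

/-! ### Prop. 3 assembled -/

/-- The oriented coefficient is clean, non-zero, of the same order, and non-terminal. -/
theorem orient_facts (q : ℕ) {B : MvPowerSeries (Fin 2) k} (hB : B ≠ 0) (hclean : cleanSeries q B = B) (hT : ¬ TermSub q B)
    (o : Bool) : orient o B ≠ 0 ∧ cleanSeries q (orient o B) = orient o B ∧ (orient o B).order = B.order ∧ ¬ TermSub q (orient o B) := by
  cases o
  · exact ⟨hB, hclean, rfl, hT⟩
  · simp only [orient_true]
    exact ⟨swap_ne_zero hB, by rw [cleanSeries_swap, hclean], order_swap B, by rw [termSub_swap]; exact hT⟩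

/-- **[HP24, Prop. 3] FOR THE GAME-SIDE FLAG INVARIANT.**  `AttainStatement p e k` holds over every field of characteristic `p`: at a
clean, non-zero, non-terminal position the flag triples have a greatest element, of finite `s`. [HP24 Prop. 3 p. 791 l. 45 – p. 792 l. 44] -/
theorem attainStatement_holds (p : ℕ) [Fact p.Prime] (k : Type) [Field k] [CharP k p] (e : ℕ) : AttainStatement p e k := by
  classical
  intro B E hclean hB _ hT
  set q := p ^ e with hq
  set m := B.order.toNat with hm
  -- per orientation: the greatest `n = 0` flag and the tangency bound
  have hN0 := exists_isN0_max_orient p e E hB hclean hT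
  choose h₀ hh₀0 hh₀N hh₀fin hh₀max using hN0
  have hfacts := orient_facts q hB hclean hT
  have hbound : ∀ o : Bool, ∃ N : ℕ, ∀ (h : PowerSeries k), PowerSeries.constantCoeff h = 0 → h ≠ 0 → N ≤ tangency h →
      dFlag q (orient o B) h (tangency h) = 0 := fun o =>
    exists_bound_dFlag_eq_zero p e (hfacts o).1 (hfacts o).2.1
  choose Nb hNb using hbound
  set N := max (Nb false) (Nb true) with hNdef
  -- the candidates
  set cand : Bool → Triple := fun o => toLex (dRes (orient o B) (orientE o E), toLex (0, sFlag q (orient o B) (orientE o E) (h₀ o)))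
    with hcand
  have hcandV : ∀ o, IsFlagTriple q B E (cand o) := fun o =>
    ⟨o, h₀ o, hh₀0 o, Or.inl (hh₀N o), by rw [hcand, flagTriple_of_isN0 q _ (hh₀N o)]⟩
  set P : Triple → Prop := fun v => IsFlagTriple q B E v ∧ (ofLex (ofLex v).2).2 = 0 ∧ 1 ≤ (ofLex v).1 ∧ (ofLex v).1 ≤ m ∧
    (ofLex (ofLex v).2).1 < N with hP
  set C : Set Triple := {cand false, cand true} ∪ {v | P v} with hC
  have hCV : ∀ v ∈ C, IsFlagTriple q B E v := by
    intro v hv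
    rcases hv with hv | hv
    · rcases hv with rfl | rfl
      · exact hcandV false
      · exact hcandV true
    · exact hv.1
  have hCfin : C.Finite := by
    refine Set.Finite.union (Set.toFinite _) ?_
    refine Set.Finite.subset ((Finset.range (m + 1) ×ˢ Finset.range N : Finset (ℕ × ℕ)).finite_toSet.image
      (fun dn : ℕ × ℕ => (toLex (dn.1, toLex (dn.2, (0 : ℕ∞))) : Triple))) ?_
    intro v hv
    obtain ⟨-, hs0, -, hdm, hnN⟩ := hv
    refine ⟨((ofLex v).1, (ofLex (ofLex v).2).1), ?_, ?_⟩
    · rw [Finset.coe_product, Set.mem_prod, Finset.coe_range, Finset.coe_range]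
      exact ⟨Nat.lt_succ_of_le hdm, hnN⟩
    · show toLex ((ofLex v).1, toLex ((ofLex (ofLex v).2).1, (0 : ℕ∞))) = v
      rw [← hs0]; rfl
  have hCne : C.Nonempty := ⟨cand false, Or.inl (Or.inl rfl)⟩
  obtain ⟨v, hvC, hvmax⟩ := Set.exists_max_image C id hCfin hCne
  refine ⟨v, hCV v hvC, ?_, ?_⟩
  · -- finite `s`
    rcases hvC with hv | hv
    · rcases hv with rfl | rfl
      · exact hh₀fin false
      · exact hh₀fin true
    · rw [hv.2.1]; exact ENat.coe_ne_top 0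
  · -- domination
    rintro w ⟨o, h, h0, hadm, rfl⟩
    by_cases hN : IsN0 (orientE o E) h
    · rw [flagTriple_of_isN0 q _ hN]
      refine le_trans ?_ (hvmax (cand o) (by cases o <;> simp [hC]))
      show toLex (dRes (orient o B) (orientE o E), toLex (0, sFlag q (orient o B) (orientE o E) h)) ≤ cand o
      exact Prod.Lex.toLex_le_toLex.mpr (Or.inr ⟨rfl, Prod.Lex.toLex_le_toLex.mpr (Or.inr ⟨rfl, hh₀max o h h0 hN⟩)⟩)
    · have htan : IsTangent (orientE o E) h := hadm.resolve_left hN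
      rw [flagTriple_of_not_isN0 q _ hN]
      have hn1 : 1 ≤ tangency h := one_le_tangency h0 htan.2.1
      by_cases hd0 : dFlag q (orient o B) h (tangency h) = 0
      · -- `d_𝓕 = 0`: dominated by the trivial flag
        refine le_trans ?_ (hvmax (cand o) (by cases o <;> simp [hC]))
        rw [hd0]
        refine le_of_lt (Prod.Lex.toLex_lt_toLex.mpr (Or.inl ?_))
        exact dRes_pos_of_not_termSub _ (hfacts o).1 (hfacts o).2.1 (hfacts o).2.2.2
      · -- `d_𝓕 ≥ 1`: a candidate
        refine hvmax _ (Or.inr ⟨⟨o, h, h0, hadm, (flagTriple_of_not_isN0 q _ hN).symm⟩, rfl, Nat.pos_of_ne_zero hd0, ?_, ?_⟩)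
        · show dFlag q (orient o B) h (tangency h) ≤ m
          rw [hm, ← (hfacts o).2.2.1]
          exact dFlag_le_order p e (hfacts o).1 (hfacts o).2.1 h h0 hn1
        · show tangency h < N
          by_contra hge
          push Not at hge
          exact hd0 (hNb o h h0 htan.2.1 (le_trans (by cases o <;> simp [hNdef]) hge))

end PurePowerFlag


end Summit.ResolutionOfSingularities.ResolutionOfSingularities.Theorems
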